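/-
Copyright: the b2b-balaban T⁴-continuum CRUX team, row NE7b, leaf lineage `t4-ne7b-formalise-leaf-03` (gen 139). Project licence.
-/
import Summits.QuantumFields.BalabanUV.T4Continuum.Spine.NE7b.LocalTermsTreeDecay

/-!
# (R2′) IN PRINT'S CURRENCY, II: local terms indexed by sets of CUBES — the near block is counted in cubes, not in coordinates:
# `∫ F e^{Q} e^{−S} e^{−V} ≤ e^{2·#𝒦₁·C₀}·C·∫ F e^{−S} e^{−V}` with `𝒦₁` the near cubes and `C₀` a PER-CUBE norm, and `C₀ := A∕(1−Δ²ρ)`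
# from a tree-decay letter on the cube graph (row NE7b, node U5c; [folklore])

Cell `pub-balaban`, sub-cell `t4`, spine estimate NE7b (`T4WeightBudget.RelWeightBound`; the cell's OWN estimate — NOT PRINTED in
[Bałaban 1983–89], NOT PROVED).  Crux-route work under `Spine/NE7b/` (FREEZE (0) crux-prover clause): [folklore] finite sums and the
OWNER's `…LocalPerturbationSandwich.perturbedMoment_le_of_shifted_fibres` BY NAME; NOTHING of Bałaban's is named, valued or asserted;
no `T4Continuum/Support` leaf typed; no `def`; zero `sorry`.

WHY.  The OWNER's `…LocalPerturbationSandwich` §3 indexes local terms by COORDINATE sets and union-bounds the near part over the near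
coordinates: `|V₁| ≤ #n₁·C₀`, price `e^{2·#n₁·C₀}`.  The crux refuter's ROOM clause (PRICING-NE7b v70 F388 (a)) located the cost:
«`b_{R2} = 2C₀#n₁` counts near COORDINATES (`N_c` per cube) … print's polymer family `E^{(k)}(X)` is O(1) per CUBE» — print's factor is
«exp O(1)|Z_j ∩ Ω_j|» with `|Z ∩ Ω|` a number of cubes ([Balaban1989LargeFieldII] p. 383 l. 21–28), its local terms living on
localization domains = unions of cubes ([Balaban1989LargeFieldI] §1).  THIS FILE re-indexes: terms `E_Y` on finite sets `Y` of cubes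
(a coordinate ↦ cube map `cube`; `E_Y` depends on the coordinates whose cube lies in `Y`), «`Y` meets the near block» iff it contains
a near coordinate's cube, a PER-CUBE norm `Σ_{Y ∋ c} w_Y ≤ C₀` on a cube set `𝒦₁` containing the near cubes, and the union bound over
`𝒦₁`: `|V₁| ≤ #𝒦₁·C₀`.  The OWNER's §2 theorem (any `V₁` with `|V₁| ≤ v` on the support, any far `V₂(x₂)`) does the rest, and
`…LocalTermsTreeDecay.perSiteNorm_le_of_treeDecay` on a CUBE graph supplies `C₀ := A∕(1−Δ²ρ)` from the tree-decay letter.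

WHAT IS PROVED ([folklore]):
* §1 CUBES: `far_cubeTerm_eq`, `sum_cubeTerms_split` (terms on cube sets not meeting a near cube are functions of the far variables;
  the split `V = V₁ + V₂(x₂)` is forced), `abs_nearCubeSum_le`, **`nearCubeNorm_le_card_mul`** (per-cube norm `C₀` on `𝒦₁ ∋` every
  near coordinate's cube ⟹ the terms meeting the near block weigh `≤ #𝒦₁·C₀`; compare the OWNER's `nearNorm_le_card_mul`: `#n₁·C₀`),
  a toy `example` (the letters jointly inhabited), **`perturbedMoment_le_of_cubeTerms`** (= the OWNER's
  `perturbedMoment_le_of_shifted_fibres` BY NAME with `V₁ :=` the terms meeting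
  the near block, `V₂ :=` the rest: `∫ F₁F₂·e^{Q₁⊕0}·e^{−S}·e^{−V} ≤ e^{2·#𝒦₁·C₀}·C·∫ F₁F₂·e^{−S}·e^{−V}` — CUBES, not coordinates;
  displayed integrabilities in the OWNER's §3 format).
* §2 JUNCTION: **`perturbedMoment_le_of_cubeTreeDecay`** (§1 with the per-cube norm DISCHARGED by
  `…LocalTermsTreeDecay.perSiteNorm_le_of_treeDecay` on a cube graph `G`, degrees `≤ Δ`, terms on `G`-connected cube sets,
  `0 ≤ w_Y ≤ A·ρ^{#Y−1}`, `Δ²ρ < 1`: factor `e^{2·#𝒦₁·A∕(1−Δ²ρ)}` — print's «exp O(1)|Z ∩ Ω|» IN KIND with `|Z ∩ Ω| = #𝒦₁` near cubes and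
  the O(1) a function of the decay letter `(A, ρ, Δ)` alone).
NOT HERE (honest): which cubes, which adjacency (`Δ = 3^4 − 1` for unions of cubes meeting along faces ∕ edges ∕ corners is a
reading), that Bałaban's effective actions SUPPLY `(A, ρ)` and the sup bounds on the small-field support — the (A1c) INSTANCE
([Balaban1989LargeFieldI] §1; NC-NE7b-α UNRULED); the MAIN action's anharmonic family (F388 (a): by value); the support clause
(Q-ne7bref-g67-1); (R1″); (A3); anything of Bałaban's.  BY-NAME EFFECT ON THE WALL: NONE.
NE7b NOT PRINTED ∕ NOT PROVED; spine PROVED 0∕9; rung (B)+1 on ONE finite T⁴ — NOT infinite volume, NOT the mass gap, NOT Clay.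
HONEST DEPENDENCY: continuum YM on T⁴ ⇐ BetaPertH ∧ nine spine estimates (0∕9 proved); BetaPertH ⇐ (D1) ∧ (D4) ∧ CAP+tail.
-/

set_option autoImplicit false

open Matrix Finset Real MeasureTheory
open Literature.Probability.LatticeModels
open Summit.QuantumFields.BalabanUV.T4Continuum.NE7b.LocalPerturbationSandwich
open Summit.QuantumFields.BalabanUV.T4Continuum.NE7b.LocalTermsTreeDecay

namespace Summit.QuantumFields.BalabanUV.T4Continuum.NE7b.LocalTermsOnCubes

/-! ## §1 Local terms on CUBES: the near block is counted in cubes, not in coordinates -/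

section Cubes

variable {n₁ n₂ : Type} [Fintype n₁] [Fintype n₂] {κ : Type*} [DecidableEq κ]

omit [Fintype n₁] [Fintype n₂] [DecidableEq κ] in
/-- **A TERM ON CUBES NOT MEETING A NEAR CUBE IS A FUNCTION OF THE FAR VARIABLES**: `E` depends on the coordinates whose cube
(`cube`) lies in `Y` only, and no near coordinate has its cube in `Y` ⟹ `E x = E (0 ⊕ x₂)`. [folklore] -/
theorem far_cubeTerm_eq (cube : n₁ ⊕ n₂ → κ) (Y : Finset κ) (E : ((n₁ ⊕ n₂) → ℝ) → ℝ)
    (hloc : ∀ x y : (n₁ ⊕ n₂) → ℝ, (∀ i, cube i ∈ Y → x i = y i) → E x = E y) (hfar : ¬ ∃ i : n₁, cube (Sum.inl i) ∈ Y)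
    (x : (n₁ ⊕ n₂) → ℝ) : E x = E (Sum.elim 0 fun j => x (Sum.inr j)) := by
  refine hloc x _ fun i hi => ?_
  cases i with
  | inl a => exact absurd ⟨a, hi⟩ hfar
  | inr b => rfl

omit [Fintype n₂] in
/-- **THE SPLIT IS FORCED (cube form)**: a sum of cube-local terms is (the terms meeting a near cube) + (a function of the far
variables). [folklore] -/
theorem sum_cubeTerms_split (cube : n₁ ⊕ n₂ → κ) (𝒴 : Finset (Finset κ)) (E : Finset κ → ((n₁ ⊕ n₂) → ℝ) → ℝ)
    (hloc : ∀ Y ∈ 𝒴, ∀ x y : (n₁ ⊕ n₂) → ℝ, (∀ i, cube i ∈ Y → x i = y i) → E Y x = E Y y) (x : (n₁ ⊕ n₂) → ℝ) :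
    ∑ Y ∈ 𝒴, E Y x =
      ∑ Y ∈ 𝒴.filter (fun Y => ∃ i : n₁, cube (Sum.inl i) ∈ Y), E Y x +
        ∑ Y ∈ 𝒴.filter (fun Y => ¬ ∃ i : n₁, cube (Sum.inl i) ∈ Y), E Y (Sum.elim 0 fun j => x (Sum.inr j)) := by
  rw [← Finset.sum_filter_add_sum_filter_not 𝒴 (fun Y => ∃ i : n₁, cube (Sum.inl i) ∈ Y)]
  congr 1
  exact Finset.sum_congr rfl fun Y hY =>
    far_cubeTerm_eq cube Y (E Y) (hloc Y (Finset.mem_filter.1 hY).1) (Finset.mem_filter.1 hY).2 x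

omit [Fintype n₂] in
/-- The near part is bounded by the sum of the sup bounds of the terms meeting a near cube. [folklore] -/
theorem abs_nearCubeSum_le (cube : n₁ ⊕ n₂ → κ) (𝒴 : Finset (Finset κ)) (E : Finset κ → ((n₁ ⊕ n₂) → ℝ) → ℝ)
    (w : Finset κ → ℝ) (x : (n₁ ⊕ n₂) → ℝ) (hw : ∀ Y ∈ 𝒴, (∃ i : n₁, cube (Sum.inl i) ∈ Y) → |E Y x| ≤ w Y) :
    |∑ Y ∈ 𝒴.filter (fun Y => ∃ i : n₁, cube (Sum.inl i) ∈ Y), E Y x| ≤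
      ∑ Y ∈ 𝒴.filter (fun Y => ∃ i : n₁, cube (Sum.inl i) ∈ Y), w Y :=
  (Finset.abs_sum_le_sum_abs _ _).trans
    (Finset.sum_le_sum fun Y hY => hw Y (Finset.mem_filter.1 hY).1 (Finset.mem_filter.1 hY).2)

omit [Fintype n₂] in
/-- **A PER-CUBE NORM GIVES THE NUMBER OF NEAR CUBES, NOT OF NEAR COORDINATES**: if every near coordinate's cube lies in `𝒦₁` and
at every cube `c ∈ 𝒦₁` the sup bounds of the terms containing it sum to at most `C₀` (`w ≥ 0`), then the sup bounds of ALL terms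
meeting a near cube sum to at most `#𝒦₁·C₀` (union bound over the near cubes; compare the OWNER's `nearNorm_le_card_mul`: `#n₁·C₀`).
[folklore] -/
theorem nearCubeNorm_le_card_mul (cube : n₁ ⊕ n₂ → κ) (𝒴 : Finset (Finset κ)) (w : Finset κ → ℝ)
    (hw0 : ∀ Y ∈ 𝒴, 0 ≤ w Y) (𝒦₁ : Finset κ) (hnear : ∀ i : n₁, cube (Sum.inl i) ∈ 𝒦₁) {C₀ : ℝ}
    (hnorm : ∀ c ∈ 𝒦₁, ∑ Y ∈ 𝒴.filter (fun Y => c ∈ Y), w Y ≤ C₀) :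
    ∑ Y ∈ 𝒴.filter (fun Y => ∃ i : n₁, cube (Sum.inl i) ∈ Y), w Y ≤ 𝒦₁.card * C₀ := by
  have h1 : ∀ Y ∈ 𝒴.filter (fun Y => ∃ i : n₁, cube (Sum.inl i) ∈ Y),
      w Y ≤ ∑ c ∈ 𝒦₁, if c ∈ Y then w Y else 0 := by
    intro Y hY
    obtain ⟨h𝒴, i, hi⟩ := Finset.mem_filter.1 hY
    calc w Y = if cube (Sum.inl i) ∈ Y then w Y else 0 := by rw [if_pos hi]
      _ ≤ ∑ c ∈ 𝒦₁, if c ∈ Y then w Y else 0 :=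
          Finset.single_le_sum (f := fun c => if c ∈ Y then w Y else 0)
            (fun c _ => by
              split_ifs
              · exact hw0 Y h𝒴
              · exact le_rfl) (hnear i)
  calc ∑ Y ∈ 𝒴.filter (fun Y => ∃ i : n₁, cube (Sum.inl i) ∈ Y), w Y
      ≤ ∑ Y ∈ 𝒴.filter (fun Y => ∃ i : n₁, cube (Sum.inl i) ∈ Y), ∑ c ∈ 𝒦₁, if c ∈ Y then w Y else 0 :=
        Finset.sum_le_sum h1
    _ = ∑ c ∈ 𝒦₁, ∑ Y ∈ 𝒴.filter (fun Y => ∃ i : n₁, cube (Sum.inl i) ∈ Y), if c ∈ Y then w Y else 0 := Finset.sum_comm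
    _ ≤ ∑ c ∈ 𝒦₁, ∑ Y ∈ 𝒴.filter (fun Y => c ∈ Y), w Y := by
        refine Finset.sum_le_sum fun c _ => ?_
        rw [← Finset.sum_filter]
        refine Finset.sum_le_sum_of_subset_of_nonneg (fun Y hY => ?_) fun Y hY _ => hw0 Y (Finset.mem_filter.1 hY).1
        simp only [Finset.mem_filter] at hY ⊢
        exact ⟨hY.1.1, hY.2⟩
    _ ≤ ∑ _c ∈ 𝒦₁, C₀ := Finset.sum_le_sum fun c hc => hnorm c hc
    _ = 𝒦₁.card * C₀ := by rw [Finset.sum_const, nsmul_eq_mul]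

/-- Toy (non-vacuity of §1's letters): `n₁ = n₂ = Fin 1`, two cubes, `cube (inl ·) = 0`, `cube (inr ·) = 1`, terms of weight `1` on
`𝒴 = {{0}, {0,1}, {1}}`, near cubes `𝒦₁ = {0}`, per-cube norm `C₀ = 2` — every letter of `nearCubeNorm_le_card_mul` discharged on
concrete data (conclusion: the terms meeting the near block weigh `≤ #𝒦₁·C₀ = 2`). -/
example :=
  nearCubeNorm_le_card_mul (n₁ := Fin 1) (n₂ := Fin 1) (Sum.elim (fun _ : Fin 1 => (0 : Fin 2)) (fun _ : Fin 1 => (1 : Fin 2)))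
    ({{0}, {0, 1}, {1}} : Finset (Finset (Fin 2))) (fun _ => (1 : ℝ)) (fun _ _ => zero_le_one) {0} (fun i => by simp) (C₀ := 2)
    fun c hc => by
      rw [Finset.mem_singleton] at hc
      subst hc
      rw [Finset.sum_const, nsmul_eq_mul, mul_one]
      exact_mod_cast (show (({{0}, {0, 1}, {1}} : Finset (Finset (Fin 2))).filter fun Y => (0 : Fin 2) ∈ Y).card ≤ 2 by decide)

/-- **(R2) WITH THE NEAR BLOCK COUNTED IN CUBES** = the OWNER's `…LocalPerturbationSandwich.perturbedMoment_le_of_shifted_fibres` BY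
NAME with `V₁ :=` the cube-local terms meeting a near cube and `V₂ :=` the rest (a function of `x₂`, §3): sup bounds `|E_Y| ≤ w_Y` on
the small-field support for the terms meeting a near cube, a per-cube norm `Σ_{Y ∋ c} w_Y ≤ C₀` on a cube set `𝒦₁` containing every
near coordinate's cube, and the UNPERTURBED fibre hypothesis `hfib` (constant `C ≥ 0`) ⟹
`∫ F₁F₂·e^{Q₁⊕0}·e^{−S}·e^{−V} ≤ e^{2·#𝒦₁·C₀}·C·∫ F₁F₂·e^{−S}·e^{−V}`.  Displayed integrabilities as in the OWNER's §3 (hybrid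
integrands: far terms kept, near terms dropped). [folklore] -/
theorem perturbedMoment_le_of_cubeTerms (S₁₁ Q₁ : Matrix n₁ n₁ ℝ) (S₁₂ : Matrix n₁ n₂ ℝ)
    (S₂₂ : Matrix n₂ n₂ ℝ) (F₁ : (n₁ → ℝ) → ℝ) (F₂ : (n₂ → ℝ) → ℝ) (cube : n₁ ⊕ n₂ → κ) (𝒴 : Finset (Finset κ))
    (E : Finset κ → ((n₁ ⊕ n₂) → ℝ) → ℝ) (w : Finset κ → ℝ) (𝒦₁ : Finset κ) {C C₀ : ℝ}
    (hF₁ : ∀ x₁, 0 ≤ F₁ x₁) (hF₂ : ∀ x₂, 0 ≤ F₂ x₂) (hC : 0 ≤ C)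
    (hloc : ∀ Y ∈ 𝒴, ∀ x y : (n₁ ⊕ n₂) → ℝ, (∀ i, cube i ∈ Y → x i = y i) → E Y x = E Y y)
    (hw : ∀ Y ∈ 𝒴, (∃ i : n₁, cube (Sum.inl i) ∈ Y) → ∀ x : (n₁ ⊕ n₂) → ℝ,
      F₁ (fun i => x (Sum.inl i)) ≠ 0 → F₂ (fun i => x (Sum.inr i)) ≠ 0 → |E Y x| ≤ w Y)
    (hw0 : ∀ Y ∈ 𝒴, 0 ≤ w Y) (hnear : ∀ i : n₁, cube (Sum.inl i) ∈ 𝒦₁)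
    (hnorm : ∀ c ∈ 𝒦₁, ∑ Y ∈ 𝒴.filter (fun Y => c ∈ Y), w Y ≤ C₀)
    (hA : Integrable fun x : n₁ ⊕ n₂ → ℝ =>
      (F₁ (fun i => x (Sum.inl i)) * (F₂ (fun i => x (Sum.inr i)) *
        exp (-(∑ Y ∈ 𝒴.filter (fun Y => ¬ ∃ i : n₁, cube (Sum.inl i) ∈ Y), E Y (Sum.elim 0 fun j => x (Sum.inr j)))))) *
        (exp (x ⬝ᵥ (Matrix.fromBlocks Q₁ 0 0 (0 : Matrix n₂ n₂ ℝ) *ᵥ x)) *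
          exp (-(x ⬝ᵥ (Matrix.fromBlocks S₁₁ S₁₂ S₁₂ᵀ S₂₂ *ᵥ x)))))
    (hB : Integrable fun x : n₁ ⊕ n₂ → ℝ =>
      (F₁ (fun i => x (Sum.inl i)) * (F₂ (fun i => x (Sum.inr i)) *
        exp (-(∑ Y ∈ 𝒴.filter (fun Y => ¬ ∃ i : n₁, cube (Sum.inl i) ∈ Y), E Y (Sum.elim 0 fun j => x (Sum.inr j)))))) *
        exp (-(x ⬝ᵥ (Matrix.fromBlocks S₁₁ S₁₂ S₁₂ᵀ S₂₂ *ᵥ x))))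
    (hB' : Integrable fun x : n₁ ⊕ n₂ → ℝ => (F₁ (fun i => x (Sum.inl i)) * F₂ (fun i => x (Sum.inr i))) *
      (exp (-(x ⬝ᵥ (Matrix.fromBlocks S₁₁ S₁₂ S₁₂ᵀ S₂₂ *ᵥ x))) * exp (-(∑ Y ∈ 𝒴, E Y x))))
    (hfib : ∀ x₂, F₂ x₂ ≠ 0 →
      ∫ x₁, F₁ x₁ * (exp (x₁ ⬝ᵥ (Q₁ *ᵥ x₁)) * exp (-(x₁ ⬝ᵥ (S₁₁ *ᵥ x₁) + 2 * (x₁ ⬝ᵥ (S₁₂ *ᵥ x₂))))) ≤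
        C * ∫ x₁, F₁ x₁ * exp (-(x₁ ⬝ᵥ (S₁₁ *ᵥ x₁) + 2 * (x₁ ⬝ᵥ (S₁₂ *ᵥ x₂))))) :
    ∫ x : n₁ ⊕ n₂ → ℝ, (F₁ (fun i => x (Sum.inl i)) * F₂ (fun i => x (Sum.inr i))) *
        ((exp (x ⬝ᵥ (Matrix.fromBlocks Q₁ 0 0 (0 : Matrix n₂ n₂ ℝ) *ᵥ x)) *
          exp (-(x ⬝ᵥ (Matrix.fromBlocks S₁₁ S₁₂ S₁₂ᵀ S₂₂ *ᵥ x)))) * exp (-(∑ Y ∈ 𝒴, E Y x))) ≤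
      (exp (2 * (𝒦₁.card * C₀)) * C) * ∫ x : n₁ ⊕ n₂ → ℝ, (F₁ (fun i => x (Sum.inl i)) * F₂ (fun i => x (Sum.inr i))) *
        (exp (-(x ⬝ᵥ (Matrix.fromBlocks S₁₁ S₁₂ S₁₂ᵀ S₂₂ *ᵥ x))) * exp (-(∑ Y ∈ 𝒴, E Y x))) := by
  have hsplit := sum_cubeTerms_split cube 𝒴 E hloc
  have hV₁ : ∀ x : n₁ ⊕ n₂ → ℝ, F₁ (fun i => x (Sum.inl i)) ≠ 0 → F₂ (fun i => x (Sum.inr i)) ≠ 0 →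
      |(fun y : n₁ ⊕ n₂ → ℝ => ∑ Y ∈ 𝒴.filter (fun Y => ∃ i : n₁, cube (Sum.inl i) ∈ Y), E Y y) x| ≤ 𝒦₁.card * C₀ :=
    fun x h1 h2 => (abs_nearCubeSum_le cube 𝒴 E w x fun Y hY ht => hw Y hY ht x h1 h2).trans
      (nearCubeNorm_le_card_mul cube 𝒴 w hw0 𝒦₁ hnear hnorm)
  have e1 : ∀ x : n₁ ⊕ n₂ → ℝ,
      exp (-(∑ Y ∈ 𝒴, E Y x)) =
        exp (-((fun y : n₁ ⊕ n₂ → ℝ => ∑ Y ∈ 𝒴.filter (fun Y => ∃ i : n₁, cube (Sum.inl i) ∈ Y), E Y y) x +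
          (fun x₂ : n₂ → ℝ => ∑ Y ∈ 𝒴.filter (fun Y => ¬ ∃ i : n₁, cube (Sum.inl i) ∈ Y), E Y (Sum.elim 0 x₂))
            (fun i => x (Sum.inr i)))) := fun x => by
    rw [hsplit x]
  have hB'' : Integrable fun x : n₁ ⊕ n₂ → ℝ => (F₁ (fun i => x (Sum.inl i)) * F₂ (fun i => x (Sum.inr i))) *
      (exp (-(x ⬝ᵥ (Matrix.fromBlocks S₁₁ S₁₂ S₁₂ᵀ S₂₂ *ᵥ x))) *
        exp (-((fun y : n₁ ⊕ n₂ → ℝ => ∑ Y ∈ 𝒴.filter (fun Y => ∃ i : n₁, cube (Sum.inl i) ∈ Y), E Y y) x +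
          (fun x₂ : n₂ → ℝ => ∑ Y ∈ 𝒴.filter (fun Y => ¬ ∃ i : n₁, cube (Sum.inl i) ∈ Y), E Y (Sum.elim 0 x₂))
            (fun i => x (Sum.inr i))))) :=
    hB'.congr (Filter.Eventually.of_forall fun x => by beta_reduce; rw [e1 x])
  have key := perturbedMoment_le_of_shifted_fibres S₁₁ Q₁ S₁₂ S₂₂ F₁ F₂
    (fun y : n₁ ⊕ n₂ → ℝ => ∑ Y ∈ 𝒴.filter (fun Y => ∃ i : n₁, cube (Sum.inl i) ∈ Y), E Y y)
    (fun x₂ : n₂ → ℝ => ∑ Y ∈ 𝒴.filter (fun Y => ¬ ∃ i : n₁, cube (Sum.inl i) ∈ Y), E Y (Sum.elim 0 x₂))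
    hF₁ hF₂ hC hV₁ hA hB hB'' hfib
  have eN : (fun x : n₁ ⊕ n₂ → ℝ => (F₁ (fun i => x (Sum.inl i)) * F₂ (fun i => x (Sum.inr i))) *
        ((exp (x ⬝ᵥ (Matrix.fromBlocks Q₁ 0 0 (0 : Matrix n₂ n₂ ℝ) *ᵥ x)) *
          exp (-(x ⬝ᵥ (Matrix.fromBlocks S₁₁ S₁₂ S₁₂ᵀ S₂₂ *ᵥ x)))) * exp (-(∑ Y ∈ 𝒴, E Y x)))) =
      fun x => (F₁ (fun i => x (Sum.inl i)) * F₂ (fun i => x (Sum.inr i))) *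
        ((exp (x ⬝ᵥ (Matrix.fromBlocks Q₁ 0 0 (0 : Matrix n₂ n₂ ℝ) *ᵥ x)) *
          exp (-(x ⬝ᵥ (Matrix.fromBlocks S₁₁ S₁₂ S₁₂ᵀ S₂₂ *ᵥ x)))) *
        exp (-((fun y : n₁ ⊕ n₂ → ℝ => ∑ Y ∈ 𝒴.filter (fun Y => ∃ i : n₁, cube (Sum.inl i) ∈ Y), E Y y) x +
          (fun x₂ : n₂ → ℝ => ∑ Y ∈ 𝒴.filter (fun Y => ¬ ∃ i : n₁, cube (Sum.inl i) ∈ Y), E Y (Sum.elim 0 x₂))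
            (fun i => x (Sum.inr i))))) := funext fun x => by rw [e1 x]
  have eD : (fun x : n₁ ⊕ n₂ → ℝ => (F₁ (fun i => x (Sum.inl i)) * F₂ (fun i => x (Sum.inr i))) *
        (exp (-(x ⬝ᵥ (Matrix.fromBlocks S₁₁ S₁₂ S₁₂ᵀ S₂₂ *ᵥ x))) * exp (-(∑ Y ∈ 𝒴, E Y x)))) =
      fun x => (F₁ (fun i => x (Sum.inl i)) * F₂ (fun i => x (Sum.inr i))) *
        (exp (-(x ⬝ᵥ (Matrix.fromBlocks S₁₁ S₁₂ S₁₂ᵀ S₂₂ *ᵥ x))) *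
        exp (-((fun y : n₁ ⊕ n₂ → ℝ => ∑ Y ∈ 𝒴.filter (fun Y => ∃ i : n₁, cube (Sum.inl i) ∈ Y), E Y y) x +
          (fun x₂ : n₂ → ℝ => ∑ Y ∈ 𝒴.filter (fun Y => ¬ ∃ i : n₁, cube (Sum.inl i) ∈ Y), E Y (Sum.elim 0 x₂))
            (fun i => x (Sum.inr i))))) := funext fun x => by rw [e1 x]
  rw [eN, eD]
  exact key

end Cubes

/-! ## §2 Junction: the per-cube norm discharged by the tree-decay letter on the cube graph -/

section Junction

variable {n₁ n₂ : Type} [Fintype n₁] [Fintype n₂]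

/-- **(R2) FROM A TREE-DECAY LETTER, CUBE FORM** = `perturbedMoment_le_of_cubeTerms` with its per-cube norm DISCHARGED by
`perSiteNorm_le_of_treeDecay` on a CUBE graph `G` (degrees `≤ Δ`; terms on `G`-connected cube sets, `0 ≤ w_Y ≤ A·ρ^{#Y−1}`,
`Δ²ρ < 1`): `∫ F₁F₂·e^{Q₁⊕0}·e^{−S}·e^{−V} ≤ e^{2·#𝒦₁·A∕(1−Δ²ρ)}·C·∫ F₁F₂·e^{−S}·e^{−V}` — print's «exp O(1)|Z ∩ Ω|» IN KIND with
`|Z ∩ Ω|` the number `#𝒦₁` of near CUBES and the O(1) a function of the decay letter `(A, ρ, Δ)` alone. [folklore] -/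
theorem perturbedMoment_le_of_cubeTreeDecay {κ : Type*} [Fintype κ] [DecidableEq κ] (S₁₁ Q₁ : Matrix n₁ n₁ ℝ)
    (S₁₂ : Matrix n₁ n₂ ℝ) (S₂₂ : Matrix n₂ n₂ ℝ) (F₁ : (n₁ → ℝ) → ℝ) (F₂ : (n₂ → ℝ) → ℝ) (cube : n₁ ⊕ n₂ → κ)
    (𝒴 : Finset (Finset κ)) (E : Finset κ → ((n₁ ⊕ n₂) → ℝ) → ℝ) (w : Finset κ → ℝ) (𝒦₁ : Finset κ) {C : ℝ}
    (G : SimpleGraph κ) [DecidableRel G.Adj] {Δ : ℕ} (hΔ : ∀ c, G.degree c ≤ Δ)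
    (hconn : ∀ Y ∈ 𝒴, IsGraphConnected G Y) {A ρ : ℝ} (hA : 0 ≤ A) (hρ0 : 0 ≤ ρ) (hρ : (Δ : ℝ) ^ 2 * ρ < 1)
    (hF₁ : ∀ x₁, 0 ≤ F₁ x₁) (hF₂ : ∀ x₂, 0 ≤ F₂ x₂) (hC : 0 ≤ C)
    (hloc : ∀ Y ∈ 𝒴, ∀ x y : (n₁ ⊕ n₂) → ℝ, (∀ i, cube i ∈ Y → x i = y i) → E Y x = E Y y)
    (hw : ∀ Y ∈ 𝒴, (∃ i : n₁, cube (Sum.inl i) ∈ Y) → ∀ x : (n₁ ⊕ n₂) → ℝ,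
      F₁ (fun i => x (Sum.inl i)) ≠ 0 → F₂ (fun i => x (Sum.inr i)) ≠ 0 → |E Y x| ≤ w Y)
    (hw0 : ∀ Y ∈ 𝒴, 0 ≤ w Y) (hwdec : ∀ Y ∈ 𝒴, w Y ≤ A * ρ ^ (Y.card - 1)) (hnear : ∀ i : n₁, cube (Sum.inl i) ∈ 𝒦₁)
    (hA' : Integrable fun x : n₁ ⊕ n₂ → ℝ =>
      (F₁ (fun i => x (Sum.inl i)) * (F₂ (fun i => x (Sum.inr i)) *
        exp (-(∑ Y ∈ 𝒴.filter (fun Y => ¬ ∃ i : n₁, cube (Sum.inl i) ∈ Y), E Y (Sum.elim 0 fun j => x (Sum.inr j)))))) *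
        (exp (x ⬝ᵥ (Matrix.fromBlocks Q₁ 0 0 (0 : Matrix n₂ n₂ ℝ) *ᵥ x)) *
          exp (-(x ⬝ᵥ (Matrix.fromBlocks S₁₁ S₁₂ S₁₂ᵀ S₂₂ *ᵥ x)))))
    (hB : Integrable fun x : n₁ ⊕ n₂ → ℝ =>
      (F₁ (fun i => x (Sum.inl i)) * (F₂ (fun i => x (Sum.inr i)) *
        exp (-(∑ Y ∈ 𝒴.filter (fun Y => ¬ ∃ i : n₁, cube (Sum.inl i) ∈ Y), E Y (Sum.elim 0 fun j => x (Sum.inr j)))))) *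
        exp (-(x ⬝ᵥ (Matrix.fromBlocks S₁₁ S₁₂ S₁₂ᵀ S₂₂ *ᵥ x))))
    (hB' : Integrable fun x : n₁ ⊕ n₂ → ℝ => (F₁ (fun i => x (Sum.inl i)) * F₂ (fun i => x (Sum.inr i))) *
      (exp (-(x ⬝ᵥ (Matrix.fromBlocks S₁₁ S₁₂ S₁₂ᵀ S₂₂ *ᵥ x))) * exp (-(∑ Y ∈ 𝒴, E Y x))))
    (hfib : ∀ x₂, F₂ x₂ ≠ 0 →
      ∫ x₁, F₁ x₁ * (exp (x₁ ⬝ᵥ (Q₁ *ᵥ x₁)) * exp (-(x₁ ⬝ᵥ (S₁₁ *ᵥ x₁) + 2 * (x₁ ⬝ᵥ (S₁₂ *ᵥ x₂))))) ≤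
        C * ∫ x₁, F₁ x₁ * exp (-(x₁ ⬝ᵥ (S₁₁ *ᵥ x₁) + 2 * (x₁ ⬝ᵥ (S₁₂ *ᵥ x₂))))) :
    ∫ x : n₁ ⊕ n₂ → ℝ, (F₁ (fun i => x (Sum.inl i)) * F₂ (fun i => x (Sum.inr i))) *
        ((exp (x ⬝ᵥ (Matrix.fromBlocks Q₁ 0 0 (0 : Matrix n₂ n₂ ℝ) *ᵥ x)) *
          exp (-(x ⬝ᵥ (Matrix.fromBlocks S₁₁ S₁₂ S₁₂ᵀ S₂₂ *ᵥ x)))) * exp (-(∑ Y ∈ 𝒴, E Y x))) ≤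
      (exp (2 * (𝒦₁.card * (A / (1 - (Δ : ℝ) ^ 2 * ρ)))) * C) *
        ∫ x : n₁ ⊕ n₂ → ℝ, (F₁ (fun i => x (Sum.inl i)) * F₂ (fun i => x (Sum.inr i))) *
          (exp (-(x ⬝ᵥ (Matrix.fromBlocks S₁₁ S₁₂ S₁₂ᵀ S₂₂ *ᵥ x))) * exp (-(∑ Y ∈ 𝒴, E Y x))) :=
  perturbedMoment_le_of_cubeTerms S₁₁ Q₁ S₁₂ S₂₂ F₁ F₂ cube 𝒴 E w 𝒦₁ hF₁ hF₂ hC hloc hw hw0 hnear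
    (fun c _ => perSiteNorm_le_of_treeDecay G hΔ 𝒴 hconn w hA hρ0 hρ hwdec c) hA' hB hB' hfib

end Junction

end Summit.QuantumFields.BalabanUV.T4Continuum.NE7b.LocalTermsOnCubes
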